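import Summits.BirchSwinnertonDyer.BirchSwinnertonDyer.Theorems.ByReductionTypeAtTwoSupersingularHalvesTwo
import Summits.BirchSwinnertonDyer.BirchSwinnertonDyer.Theorems.ByReductionTypeAtTwoSupersingularLineEulerChar
import Summits.BirchSwinnertonDyer.Rank1Residual.Supersingular.SprungPollackConsistency
import HarnessLib

/-!
# Route `ByReductionTypeAtTwo` (rung K4), crux `SupersingularRankZeroAtTwo` (item
# stmt-BirchSwinnertonDyer-19097), line `signed_halves_two` v3: THE RANK-ZERO PINCH AT `p = 2` —
# the hardest stub `stub_zeroKobayashiLower` FOLLOWS from the other two `a₂ = 0` stubs plus the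
# descent half `MissingLowerBoundAt W 2` (seat `bsd-2adic-ss-1`, GEN 5)

HONEST FRAMING (cell `bsd-2adic`, run/shared/lean/pub/bsd-2adic/, HUMAN RULINGS D-0036/D-0059/D-0074):
THEOREMS ONLY, against the registered crux constant and the registered stub signatures of line
`signed_halves_two` (tree `Cruxes/SupersingularRankZeroAtTwo/Lines/signed_halves_two.lean`, skeleton
sha `577d1c0febb0429b…`); every research input an explicit hypothesis; no definition, no named fact,
no `sorry`; nothing booked; BSD is not proved by any of this. PARTITION (D-0054): X5@2 good-ss (B1·O1;
757 r0 book230 classes; the `a₂ = 0` sub-row = 208) × p = 2 — types-the-object-of; closes none.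
bears_on: K4 (route-BirchSwinnertonDyer-ByReductionTypeAtTwo item 19097).

## What is proved, and why it matters for the line

On the `a₂ = 0` sub-row the line has three research stubs on Kobayashi's REAL object
`X⁺(E/ℚ_∞)` (`Kobayashi2003.SignedSelmerDualData W κ γ 1`) and Pollack's/Sprung's `L♭` at `2`:
(2) `stub_zeroSignedEulerChar` (B. D. Kim's signed `Γ`-Euler characteristic at `2`), (3)
`stub_zeroKobayashiLower` = `KobayashiLowerDivisibility W 2 1` (the Eisenstein half, HARDEST: no
printed method at `2`), (4) `stub_zeroSignedUpper` (the Kato-side divisibility at `2`: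
`char X⁺ = (g)`, `ι(g·h) = ϖ·ι L♭`). THIS FILE: in analytic rank `0`, stub (3) is NOT an
independent obligation —

* `kobayashiMainConjecture_two_one_of_upper_of_missingLowerBound` (**the pinch, per curve**): for
  `E = W` good at `2` with `a₂ = 0` and `L(E,1) ≠ 0`, the Kato-side package {Kobayashi 1.2 at `2`
  (`h12`), Kim 3.15 at `2` (`hKim`), the Kato-side divisibility at `2` (`hup`)} together with the
  DESCENT half `MissingLowerBoundAt W 2` (`ord₂ #Ш_an ≤ ord₂ #Ш`) give the FULL even signed main
  conjecture at `2`, `KobayashiMainConjecture W 2 1` — for EVERY cyclotomic datum, newform, period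
  ratio `ϖ`, Pollack pair and dual datum. Proof: `ι(g·h) = ϖ·ι L♭` gives `g(0)·h(0) = ϖ·L♭(0) = t`
  with `t = L(E,1)/Ω_E` (at `2`, `a₂ = 0`, EVERY Pollack pair is a Sprung pair with `a = 0` —
  `isSprungPair_zero_iff` — so `L♭(0) = c♭·[0]⁺_f` with `c♭ = −a₂² + 2a₂ + 1 = 1`,
  `constantCoeff_flat_two_of_isSprungPair_of_isNewformOf`); Kim gives `v₂ g(0) = v₂ ∏c_ℓ + v₂ #Ш`
  (`valuation_constantCoeff_xi`); the descent half reads `v₂ t − v₂ ∏c_ℓ ≤ v₂ #Ш`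
  (`padicValRat_shaAn_witness`, `#E(ℚ)(2) = 1` by `P2.irr_two_of_goodSS_two`); hence
  `v₂ h(0) = v₂ t − v₂ g(0) ≤ 0`, and `h ∈ Λ` forces `v₂ h(0) = 0`, so `h(0) ∈ ℤ₂ˣ`, so `h ∈ Λˣ`
  (`PowerSeries.isUnit_iff_constantCoeff`), so `char X⁺ = (g) = (g·h)` with `ι(g·h) = ϖ·ι L♭` on the
  nose. (The odd-`p` shape of this squeeze is Greenberg's "one divisibility + the exact order of
  `Ш` ⇒ equality", LNM 1716 §4; the multiplicative-at-`2` sibling in this cell is the INT pinch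
  `O1.bsdp_two_split_of_katoIntPinch`.)
  (Corollaries: the Eisenstein half by `kobayashiLowerDivisibility_of_mainConjecture`, `h = 1`; and
  `BSDp W 2` with the landed Kato half `missingUpperBoundAt_two_of_signedUpperDivisibility_two`, p420436.)
* `bsdp_two_of_upper_of_pow_dvd` — **the certificate-fed door**: the descent half supplied as a
  finite datum `#Ш_an = q`, `v₂ q ≤ m`, `2^m ∣ #Ш` (per class: eng-2's TWO-ENGINE Cassels–Tate
  certificate CERT-CT2-X5ALL `Ш[2] ⊂ 2Ш[4]` gives `2⁴ ∣ #Ш` at every rank-`0` K = 2 member, 705 of the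
  757 ss classes) ⇒ `BSDp W 2 ∧ KobayashiMainConjecture W 2 1` from stubs (2)+(4) alone at that curve.
* CLASS LEVEL, on the registered stub signatures VERBATIM:
  `zeroKobayashiMainConjecture_of_eulerChar_of_upper_of_millerLower` (stubs (1)(2)(4) + the Miller
  lower half on `a₂ = 0` ⇒ `KobayashiMainConjecture W 2 1` on the whole `a₂ = 0` sub-row, hence THE
  STATEMENT OF `stub_zeroKobayashiLower`), `zeroKobayashiLower_iff_zeroMillerLower` (given stubs
  (1)(2)(4): stub (3) ⟺ the Miller lower half on `a₂ = 0`; `⇒` is p420436), and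
  `supersingularRankZeroAtTwo_of_eulerChar_of_upper_of_millerHalves` (the crux from stubs (1)(2)(4)(5)
  + the Miller lower half on `a₂ = 0`, via the landed `supersingularRankZeroAtTwo_of_line_eulerChar`).

So, for the planner: on the crux's (rank-`0`) domain the line's HARDEST stub is EXACTLY the descent
lower bound — certificate-shaped per class (closed today on every K = 2 class by CERT-CT2-X5ALL),
conjecture-shaped only as a ∀-statement; the research content of the `a₂ = 0` sub-row is stubs (2) and
(4) (Kobayashi §§6–9 / Kim at `p = 2`, even sign — unprinted; computed local evidence GEN 4). No
reshape of the registered skeleton is made here (v3 stands); this file is the `--supports` record of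
the equivalence.

References: S. Kobayashi, Invent. Math. 152 (2003) Thm. 1.2, Thm. 4.1, Conjecture p. 2 [Kobayashi2003];
B. D. Kim, J. Aust. Math. Soc. 95 (2013) Cor. 3.15 [BDKim2013]; R. Greenberg, LNM 1716 (1999) §4
pp. 102–105 [GreenbergLNM1716]; F. Sprung, ANT 11 (2017) Thm. 1.12, Cor. 4.4, Cor. 4.11 row `p = 2`
[Sprung2017]; R. Pollack, Duke 118 (2003) Prop. 6.18 [Pollack2003]; R. L. Miller, LMS JCM 14 (2011)
Def. 1.1 [Miller2011LMS]; J. W. S. Cassels 1998 §1 (the `Ш[2] ⊂ 2Ш[4]` certificate currency) [Cassels1998].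
-/

set_option autoImplicit false
-- the Theorems namespace of this sub repeats the summit name by design (D-0017 nested layout)
set_option linter.dupNamespace false

noncomputable section

open scoped Classical MatrixGroups ModularForm

open CongruenceSubgroup WeierstrassCurve Literature.NumberTheory.EllipticCurves
  Literature.NumberTheory.EllipticCurves.ModularForms Literature.NumberTheory.EllipticCurves.Sprung2017
  Literature.NumberTheory.EllipticCurves.Rank1Residual Literature.NumberTheory.EllipticCurves.Rank1Residual.Typed
  Literature.NumberTheory.EllipticCurves.Kobayashi2003 Literature.NumberTheory.EllipticCurves.IwasawaDual
  ZpExtension Summit.BirchSwinnertonDyer.Rank1Residual Summit.BirchSwinnertonDyer.Rank1Residual.Supersingular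

namespace Summit.BirchSwinnertonDyer.BirchSwinnertonDyer.Theorems

/-! ## §1 The pinch, per curve: Kato-side package + descent lower bound ⇒ the even main conjecture at `2` -/

section Pinch

variable (W : WeierstrassCurve ℚ) [W.IsElliptic] [W.IsGloballyMinimal]

/-- **THE RANK-ZERO PINCH AT `p = 2`, `a₂ = 0`.** For `E = W` with good reduction at `2`, `a₂ = 0`
and `L(E,1) ≠ 0`, granted GZK (`hGZK`): the typed Kato-side package at `2` on the REAL objects —
Kobayashi Thm. 1.2 at `2` (`h12`: every dual datum of `Sel⁺(E/ℚ_∞)` is f.g. `Λ`-torsion), Kim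
Cor. 3.15 at `2` (`hKim`: a generator `g` of `char X⁺` has `g(0) = u·2^{v₂∏c_ℓ}·#Sel_{2^∞}(E/ℚ)`), the
Kato-side divisibility at `2` (`hup`: `char X⁺ = (g)`, `ι(g·h) = ϖ·ι L♭` over every Pollack pair at `2`)
— together with the DESCENT half `MissingLowerBoundAt W 2` (`ord₂ #Ш_an ≤ ord₂ #Ш`) imply the FULL
even signed main conjecture at `2`, `KobayashiMainConjecture W 2 1`. Chain: `g(0)·h(0) = ϖ·L♭(0) = t`,
`t = L(E,1)/Ω_E` (`c♭ = 1` at `a₂ = 0`; every Pollack pair at `2` is a Sprung pair with `a = 0`);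
`v₂ g(0) = v₂∏c + v₂#Ш ≥ v₂ t` by Kim + the descent half; so `v₂ h(0) ≤ 0`, `h ∈ Λ` ⇒ `h(0) ∈ ℤ₂ˣ`
⇒ `h ∈ Λˣ` ⇒ `(g) = (g·h)` and `ι(g·h) = ϖ·ι L♭`. Nothing beyond the displayed binders is used.
[cite: Kobayashi2003, Thm. 1.2, Thm. 4.1 and Conjecture (p. 2)] [cite: BDKim2013, Cor. 3.15 (p. 199)]
[cite: GreenbergLNM1716, §4 pp. 102–105] [cite: Sprung2017, Cor. 4.4 and Cor. 4.11 (row p = 2)]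
[cite: Miller2011LMS, Def. 1.1] -/
theorem kobayashiMainConjecture_two_one_of_upper_of_missingLowerBound
    (hGZK : rank_eq_analyticRank_of_analyticRank_le_one)
    (hgood : W.HasGoodReductionAtPrime 2) (ha : W.frobeniusTrace 2 = 0)
    (hL : W.entireLFunction 1 ≠ 0)
    (h12 : ∀ (κ : ZpExtension ℚ 2) (γ : Field.absoluteGaloisGroup ℚ),
      κ.IsCyclotomic → κ.IsTopGenerator γ →
      ∀ D : SignedSelmerDualData W κ γ 1,
        Module.Finite (IwasawaAlgebra 2) D.X ∧ Module.IsTorsion (IwasawaAlgebra 2) D.X)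
    (hKim : ∀ (κ : ZpExtension ℚ 2) (γ : Field.absoluteGaloisGroup ℚ),
      κ.IsCyclotomic → κ.IsTopGenerator γ →
      ∀ (D : SignedSelmerDualData W κ γ 1) [Module.Finite (IwasawaAlgebra 2) D.X],
        Module.IsTorsion (IwasawaAlgebra 2) D.X →
      ∀ g : IwasawaAlgebra 2, D.charIdeal = Ideal.span {g} → Finite (W.selmerGroupPInfty 2) →
        ∃ u : ℤ_[2]ˣ, ((PowerSeries.constantCoeff g : ℤ_[2]) : ℚ_[2]) =
          ((u : ℤ_[2]) : ℚ_[2]) * ((2 : ℕ) : ℚ_[2]) ^ (padicValNat 2 W.tamagawaProduct) *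
            (Nat.card (W.selmerGroupPInfty 2) : ℚ_[2]))
    (hup : ∀ (κ : ZpExtension ℚ 2) (γ : Field.absoluteGaloisGroup ℚ),
      κ.IsCyclotomic → κ.IsTopGenerator γ → IsCyclotomicVariable 2 γ →
      ∀ [NeZero (W.conductorNorm ℤ)] (f : CuspForm (Gamma0 (W.conductorNorm ℤ)) 2),
        IsNewformOf W f → ∀ (ϖ : ℚ), (ϖ : ℝ) * W.realPeriodRat = plusPeriod f →
      ∀ (Lplus Lminus : IwasawaAlgebra 2), IsPollackPair f 2 Lplus Lminus →
      ∀ (D : SignedSelmerDualData W κ γ 1),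
        ∃ g h : IwasawaAlgebra 2, D.charIdeal = Ideal.span {g} ∧
          iwasawaToPowerSeries 2 (g * h) =
            PowerSeries.C (ϖ : ℚ_[2]) * iwasawaToPowerSeries 2 (kobayashiL 1 Lplus Lminus))
    (hlow : MissingLowerBoundAt W 2) : KobayashiMainConjecture W 2 1 := by
  intro κ γ hκ hγ hγ' _ f hf ϖ hϖ Lp Lm hPP D
  obtain ⟨hFin, hTors⟩ := h12 κ γ hκ hγ D
  haveI := hFin
  refine ⟨hTors, ?_⟩
  obtain ⟨g, h, hchar, hgh⟩ := hup κ γ hκ hγ hγ' f hf ϖ hϖ Lp Lm hPP D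
  have hkL : kobayashiL (1 : ℤˣ) Lp Lm = Lm := by unfold kobayashiL; rw [if_pos rfl]
  rw [hkL] at hgh ⊢
  -- the analytic number `t = L(E,1)/Ω_E = ϖ · [0]⁺_f`
  set s : ℚ := ratPlusSymbol f 0 with hs_def
  set t : ℚ := ϖ * s with ht_def
  have hLval : W.entireLFunction 1 = (((s : ℝ) * plusPeriod f : ℝ) : ℂ) := hf.entireLFunction_one_eq
  have hΩC : (W.realPeriodRat : ℂ) ≠ 0 :=
    Complex.ofReal_ne_zero.mpr W.realPeriodRat_pos_holds.ne'
  have ht : W.entireLFunction 1 / (W.realPeriodRat : ℂ) = ((t : ℚ) : ℂ) := by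
    rw [hLval, ← hϖ, div_eq_iff hΩC, ht_def]
    push_cast
    ring
  have hs0 : s ≠ 0 := by
    intro h0
    apply hL
    rw [hLval, h0]
    simp
  have hϖ0 : ϖ ≠ 0 := by
    intro h0
    apply hL
    rw [hLval, ← hϖ, h0]
    simp
  have ht0 : t ≠ 0 := mul_ne_zero hϖ0 hs0
  -- at `2`, `a₂ = 0`, every Pollack pair is a Sprung pair with `a = 0`, so `L♭(0) = c♭·[0]⁺ = [0]⁺`
  have hSP : IsSprungPair f 2 (W.frobeniusTrace 2) Lp Lm := by
    rw [ha]
    exact (isSprungPair_zero_iff f 2 Lp Lm).mpr ⟨hPP.2.2.1, hPP.2.2.2⟩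
  have hLm0 := constantCoeff_flat_two_of_isSprungPair_of_isNewformOf hf hgood hSP
  rw [ha] at hLm0
  have hϖLm : (ϖ : ℚ_[2]) * ((PowerSeries.constantCoeff Lm : ℤ_[2]) : ℚ_[2]) = ((t : ℚ) : ℚ_[2]) := by
    rw [hLm0, ht_def]
    push_cast
    ring
  -- Kim at `2`: `g(0) ≠ 0`, `v₂ g(0) = v₂ ∏c + v₂ #Ш`
  have hr : W.analyticRank = 0 := analyticRank_eq_zero_of_entireLFunction_one_ne_zero W hL
  have hK : (⟨g, 0, 0⟩ : SignedDatum W 2).EulerCharacteristic := fun hfin ↦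
    hKim κ γ hκ hγ D hTors g hchar hfin
  obtain ⟨hg0ne, hvg⟩ := valuation_constantCoeff_xi W 2 hGZK hL ⟨g, 0, 0⟩ hK
  -- the Kato side at `2`: `g(0) · h(0) = ϖ · L♭(0) = t`
  have hc := congrArg PowerSeries.constantCoeff hgh
  rw [constantCoeff_iwasawaToPowerSeries, map_mul, PadicInt.coe_mul, map_mul,
    PowerSeries.constantCoeff_C, constantCoeff_iwasawaToPowerSeries, hϖLm] at hc
  have htQ : ((t : ℚ) : ℚ_[2]) ≠ 0 := by exact_mod_cast ht0
  have hh0 : ((PowerSeries.constantCoeff h : ℤ_[2]) : ℚ_[2]) ≠ 0 := fun h0 ↦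
    htQ (by rw [← hc, h0, mul_zero])
  have hval := congrArg Padic.valuation hc
  rw [Padic.valuation_mul hg0ne hh0, Padic.valuation_ratCast, hvg] at hval
  have hhnn := valuation_coe_padicInt_nonneg _ hh0
  -- the descent half: `v₂ t − v₂ ∏c ≤ v₂ #Ш` (`#E(ℚ)(2) = 1`)
  have hirr : W.HasIrreducibleModPGaloisRep 2 :=
    P2.irr_two_of_goodSS_two W ⟨hgood, by rw [ha]; exact dvd_zero _⟩
  obtain ⟨q, hq, hle⟩ := hlow
  have hqeq : q = t * (W.torsionOrder : ℚ) ^ 2 / (W.tamagawaProduct : ℚ) := by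
    have h1 := hq.symm.trans (shaAn_eq_of_analyticRank_eq_zero W hGZK hr ht)
    exact_mod_cast h1
  rw [hqeq, padicValRat_shaAn_witness W 2 hirr ht0] at hle
  -- so `h(0)` is a `2`-adic unit and `h` is a unit of `Λ`
  have hv0 : ((PowerSeries.constantCoeff h : ℤ_[2]) : ℚ_[2]).valuation = 0 := by
    linarith
  have hunit : IsUnit h :=
    PowerSeries.isUnit_iff_constantCoeff.mpr (isUnit_of_valuation_coe_eq_zero _ hh0 hv0)
  refine ⟨g * h, ?_, hgh⟩
  rw [hchar]
  exact (Ideal.span_singleton_mul_right_unit hunit g).symm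

/-- **The certificate-fed door.** The descent half supplied as a FINITE DATUM — `#Ш_an = q` (record),
`v₂ q ≤ m`, `2^m ∣ #Ш(E/ℚ)` (per curve: a level-`(4,2)` Cassels–Tate / 4-descent certificate
`Ш[2] ⊂ 2Ш[4]` gives `m = 4`, the shape of eng-2's CERT-CT2-X5ALL at every rank-`0` K = 2 member) —
plus the Kato-side package at `2` ⇒ `BSD(E,2)` AND the full even main conjecture at `2` for this curve.
[cite: Miller2011LMS, Def. 1.1] [cite: Cassels1998, §1] [cite: Kobayashi2003, Conjecture (p. 2) and Thm. 4.1] -/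
theorem bsdp_two_of_upper_of_pow_dvd
    (hmod : nonempty_modularParametrizationData)
    (hGZK : rank_eq_analyticRank_of_analyticRank_le_one)
    (hgood : W.HasGoodReductionAtPrime 2) (ha : W.frobeniusTrace 2 = 0)
    (hL : W.entireLFunction 1 ≠ 0)
    (h12 : ∀ (κ : ZpExtension ℚ 2) (γ : Field.absoluteGaloisGroup ℚ),
      κ.IsCyclotomic → κ.IsTopGenerator γ →
      ∀ D : SignedSelmerDualData W κ γ 1,
        Module.Finite (IwasawaAlgebra 2) D.X ∧ Module.IsTorsion (IwasawaAlgebra 2) D.X)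
    (hKim : ∀ (κ : ZpExtension ℚ 2) (γ : Field.absoluteGaloisGroup ℚ),
      κ.IsCyclotomic → κ.IsTopGenerator γ →
      ∀ (D : SignedSelmerDualData W κ γ 1) [Module.Finite (IwasawaAlgebra 2) D.X],
        Module.IsTorsion (IwasawaAlgebra 2) D.X →
      ∀ g : IwasawaAlgebra 2, D.charIdeal = Ideal.span {g} → Finite (W.selmerGroupPInfty 2) →
        ∃ u : ℤ_[2]ˣ, ((PowerSeries.constantCoeff g : ℤ_[2]) : ℚ_[2]) =
          ((u : ℤ_[2]) : ℚ_[2]) * ((2 : ℕ) : ℚ_[2]) ^ (padicValNat 2 W.tamagawaProduct) *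
            (Nat.card (W.selmerGroupPInfty 2) : ℚ_[2]))
    (hup : ∀ (κ : ZpExtension ℚ 2) (γ : Field.absoluteGaloisGroup ℚ),
      κ.IsCyclotomic → κ.IsTopGenerator γ → IsCyclotomicVariable 2 γ →
      ∀ [NeZero (W.conductorNorm ℤ)] (f : CuspForm (Gamma0 (W.conductorNorm ℤ)) 2),
        IsNewformOf W f → ∀ (ϖ : ℚ), (ϖ : ℝ) * W.realPeriodRat = plusPeriod f →
      ∀ (Lplus Lminus : IwasawaAlgebra 2), IsPollackPair f 2 Lplus Lminus →
      ∀ (D : SignedSelmerDualData W κ γ 1),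
        ∃ g h : IwasawaAlgebra 2, D.charIdeal = Ideal.span {g} ∧
          iwasawaToPowerSeries 2 (g * h) =
            PowerSeries.C (ϖ : ℚ_[2]) * iwasawaToPowerSeries 2 (kobayashiL 1 Lplus Lminus))
    {q : ℚ} (hq : shaAn W = (q : ℂ)) {m : ℕ} (hv : padicValRat 2 q ≤ m)
    (hdvd : 2 ^ m ∣ W.shaOrder) : BSDp W 2 ∧ KobayashiMainConjecture W 2 1 := by
  have hr : W.analyticRank = 0 := analyticRank_eq_zero_of_entireLFunction_one_ne_zero W hL
  -- the finite datum is a lower bound: `2^m ∣ #Ш ≠ 0 ⇒ m ≤ v₂ #Ш`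
  haveI : Finite W.sha := (hGZK W (by omega)).2
  have hn : W.shaOrder ≠ 0 := by
    rw [WeierstrassCurve.shaOrder]
    exact (Nat.card_pos (α := W.sha)).ne'
  have hle : m ≤ padicValNat 2 W.shaOrder := (padicValNat_dvd_iff_le hn).1 hdvd
  have hlow : MissingLowerBoundAt W 2 := ⟨q, hq, hv.trans (by exact_mod_cast hle)⟩
  exact ⟨bsdp_of_missingPPartAt W 2 hGZK (by omega) (missingPPartAt_of_lower_of_upper W 2 hlow
      (missingUpperBoundAt_two_of_signedUpperDivisibility_two W hmod hGZK hgood ha hL h12 hKim hup)),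
    kobayashiMainConjecture_two_one_of_upper_of_missingLowerBound W hGZK hgood ha hL h12 hKim hup hlow⟩

end Pinch

/-! ## §2 Class level, on the registered stub signatures of line `signed_halves_two` v3 -/

section ClassLevel

/-- **Stubs (1)(2)(4) + the Miller lower half on `a₂ = 0` ⇒ the FULL even main conjecture at `2` on the
whole `a₂ = 0` sub-row.** Binders VERBATIM the registered signatures: `hPub` = `stub_ssPub`, `hEC` =
`stub_zeroSignedEulerChar` (from which Kobayashi's torsion and Kim's generator value follow by the
landed `signedTorsion_two_of_eulerChar` / `signedKim_two_of_eulerChar`, finite generation being the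
tree theorem `signedSelmerDual_moduleFinite_two`), `hup` = `stub_zeroSignedUpper`; `hML` = Miller's
lower half `MissingLowerBoundAt W 2` on the `a₂ = 0` sub-row (certificate-shaped per class). Then
`KobayashiMainConjecture W 2 1` for every curve of the sub-row (the pinch of §1, `L(E,1) ≠ 0` from
modularity by `entireLFunction_one_ne_zero_of_analyticRank_eq_zero`).
[cite: Kobayashi2003, Thm. 1.2, Thm. 4.1 and Conjecture (p. 2)] [cite: BDKim2013, Thm. 1.1 and Cor. 3.15]
[cite: Miller2011LMS, Def. 1.1] -/
theorem zeroKobayashiMainConjecture_of_eulerChar_of_upper_of_millerLower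
    (hPub : nonempty_modularParametrizationData ∧ rank_eq_analyticRank_of_analyticRank_le_one)
    (hEC : ∀ (W : WeierstrassCurve ℚ) [W.IsElliptic] [W.IsGloballyMinimal],
        ¬ W.HasCM → W.analyticRank = 0 → GoodSS W 2 → W.frobeniusTrace 2 = 0 →
        ∀ (κ : ZpExtension ℚ 2) (γ : Field.absoluteGaloisGroup ℚ),
          κ.IsCyclotomic → κ.IsTopGenerator γ → Finite (W.selmerGroupPInfty 2) →
          Finite (endInvariants (conjSignedSelmerInfty W κ 1 γ - 1)) ∧
            ∃ u : ℤ_[2]ˣ, (Nat.card (endInvariants (conjSignedSelmerInfty W κ 1 γ - 1)) : ℚ_[2]) =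
              ((u : ℤ_[2]) : ℚ_[2]) * ((2 : ℕ) : ℚ_[2]) ^ (padicValNat 2 W.tamagawaProduct) *
                (Nat.card (W.selmerGroupPInfty 2) : ℚ_[2]) *
                  (Nat.card (EndCoinvariants (conjSignedSelmerInfty W κ 1 γ - 1)) : ℚ_[2]))
    (hup : ∀ (W : WeierstrassCurve ℚ) [W.IsElliptic] [W.IsGloballyMinimal],
      ¬ W.HasCM → W.analyticRank = 0 → GoodSS W 2 → W.frobeniusTrace 2 = 0 →
      ∀ (κ : ZpExtension ℚ 2) (γ : Field.absoluteGaloisGroup ℚ),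
        κ.IsCyclotomic → κ.IsTopGenerator γ → IsCyclotomicVariable 2 γ →
        ∀ [NeZero (W.conductorNorm ℤ)] (f : CuspForm (Gamma0 (W.conductorNorm ℤ)) 2),
          IsNewformOf W f → ∀ (ϖ : ℚ), (ϖ : ℝ) * W.realPeriodRat = plusPeriod f →
        ∀ (Lplus Lminus : IwasawaAlgebra 2), IsPollackPair f 2 Lplus Lminus →
        ∀ (D : SignedSelmerDualData W κ γ 1),
          ∃ g h : IwasawaAlgebra 2, D.charIdeal = Ideal.span {g} ∧
            iwasawaToPowerSeries 2 (g * h) =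
              PowerSeries.C (ϖ : ℚ_[2]) * iwasawaToPowerSeries 2 (kobayashiL 1 Lplus Lminus))
    (hML : ∀ (W : WeierstrassCurve ℚ) [W.IsElliptic] [W.IsGloballyMinimal],
      ¬ W.HasCM → W.analyticRank = 0 → GoodSS W 2 → W.frobeniusTrace 2 = 0 →
        MissingLowerBoundAt W 2) :
    ∀ (W : WeierstrassCurve ℚ) [W.IsElliptic] [W.IsGloballyMinimal],
      ¬ W.HasCM → W.analyticRank = 0 → GoodSS W 2 → W.frobeniusTrace 2 = 0 →
        KobayashiMainConjecture W 2 1 := by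
  intro W _ _ hcm hr hss ha
  have hL : W.entireLFunction 1 ≠ 0 := entireLFunction_one_ne_zero_of_analyticRank_eq_zero W hPub.1 hr
  have hTor := signedTorsion_two_of_eulerChar hPub.2 hEC W hcm hr hss ha
  have hKim := signedKim_two_of_eulerChar hEC W hcm hr hss ha
  have hFin := signedSelmerDual_moduleFinite_two W hcm hr hss ha
  exact kobayashiMainConjecture_two_one_of_upper_of_missingLowerBound W hPub.2 hss.1 ha hL
    (fun κ γ hκ hγ D ↦ ⟨hFin κ γ hκ hγ 1 D, hTor κ γ hκ hγ D⟩)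
    (fun κ γ hκ hγ D _ htor g hg hSel ↦ hKim κ γ hκ hγ D htor g hg hSel)
    (hup W hcm hr hss ha) (hML W hcm hr hss ha)

/-- **Given stubs (1)(2)(4), stub (3) ⟺ the Miller lower half on `a₂ = 0`.** `⇐` is the pinch;
`⇒` is the landed Eisenstein-half bookkeeping `missingLowerBoundAt_two_of_kobayashiLowerDivisibility_two`
(p420436). So the registered `stub_zeroKobayashiLower` and "`MissingLowerBoundAt W 2` on the `a₂ = 0`
sub-row" are INTERCHANGEABLE as the third stub of the line.
[cite: Kobayashi2003, Conjecture (p. 2), Thm. 1.2 and Thm. 4.1] [cite: BDKim2013, Cor. 3.15 (p. 199)]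
[cite: Miller2011LMS, Def. 1.1] -/
theorem zeroKobayashiLower_iff_zeroMillerLower
    (hPub : nonempty_modularParametrizationData ∧ rank_eq_analyticRank_of_analyticRank_le_one)
    (hEC : ∀ (W : WeierstrassCurve ℚ) [W.IsElliptic] [W.IsGloballyMinimal],
        ¬ W.HasCM → W.analyticRank = 0 → GoodSS W 2 → W.frobeniusTrace 2 = 0 →
        ∀ (κ : ZpExtension ℚ 2) (γ : Field.absoluteGaloisGroup ℚ),
          κ.IsCyclotomic → κ.IsTopGenerator γ → Finite (W.selmerGroupPInfty 2) →
          Finite (endInvariants (conjSignedSelmerInfty W κ 1 γ - 1)) ∧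
            ∃ u : ℤ_[2]ˣ, (Nat.card (endInvariants (conjSignedSelmerInfty W κ 1 γ - 1)) : ℚ_[2]) =
              ((u : ℤ_[2]) : ℚ_[2]) * ((2 : ℕ) : ℚ_[2]) ^ (padicValNat 2 W.tamagawaProduct) *
                (Nat.card (W.selmerGroupPInfty 2) : ℚ_[2]) *
                  (Nat.card (EndCoinvariants (conjSignedSelmerInfty W κ 1 γ - 1)) : ℚ_[2]))
    (hup : ∀ (W : WeierstrassCurve ℚ) [W.IsElliptic] [W.IsGloballyMinimal],
      ¬ W.HasCM → W.analyticRank = 0 → GoodSS W 2 → W.frobeniusTrace 2 = 0 →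
      ∀ (κ : ZpExtension ℚ 2) (γ : Field.absoluteGaloisGroup ℚ),
        κ.IsCyclotomic → κ.IsTopGenerator γ → IsCyclotomicVariable 2 γ →
        ∀ [NeZero (W.conductorNorm ℤ)] (f : CuspForm (Gamma0 (W.conductorNorm ℤ)) 2),
          IsNewformOf W f → ∀ (ϖ : ℚ), (ϖ : ℝ) * W.realPeriodRat = plusPeriod f →
        ∀ (Lplus Lminus : IwasawaAlgebra 2), IsPollackPair f 2 Lplus Lminus →
        ∀ (D : SignedSelmerDualData W κ γ 1),
          ∃ g h : IwasawaAlgebra 2, D.charIdeal = Ideal.span {g} ∧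
            iwasawaToPowerSeries 2 (g * h) =
              PowerSeries.C (ϖ : ℚ_[2]) * iwasawaToPowerSeries 2 (kobayashiL 1 Lplus Lminus)) :
    (∀ (W : WeierstrassCurve ℚ) [W.IsElliptic] [W.IsGloballyMinimal],
      ¬ W.HasCM → W.analyticRank = 0 → GoodSS W 2 → W.frobeniusTrace 2 = 0 →
        KobayashiLowerDivisibility W 2 1) ↔
    (∀ (W : WeierstrassCurve ℚ) [W.IsElliptic] [W.IsGloballyMinimal],
      ¬ W.HasCM → W.analyticRank = 0 → GoodSS W 2 → W.frobeniusTrace 2 = 0 →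
        MissingLowerBoundAt W 2) := by
  constructor
  · intro hlow W _ _ hcm hr hss ha
    have hL : W.entireLFunction 1 ≠ 0 := entireLFunction_one_ne_zero_of_analyticRank_eq_zero W hPub.1 hr
    have hTor := signedTorsion_two_of_eulerChar hPub.2 hEC W hcm hr hss ha
    have hKim := signedKim_two_of_eulerChar hEC W hcm hr hss ha
    have hFin := signedSelmerDual_moduleFinite_two W hcm hr hss ha
    exact missingLowerBoundAt_two_of_kobayashiLowerDivisibility_two W hPub.1 hPub.2 hss.1 ha hL
      (fun κ γ hκ hγ D ↦ ⟨hFin κ γ hκ hγ 1 D, hTor κ γ hκ hγ D⟩)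
      (fun κ γ hκ hγ D _ htor g hg hSel ↦ hKim κ γ hκ hγ D htor g hg hSel) (hlow W hcm hr hss ha)
  · intro hML W _ _ hcm hr hss ha
    exact kobayashiLowerDivisibility_of_mainConjecture
      (zeroKobayashiMainConjecture_of_eulerChar_of_upper_of_millerLower hPub hEC hup hML W hcm hr hss ha)

/-- **THE CRUX from stubs (1)(2)(4)(5) + the Miller lower half on `a₂ = 0`** — i.e. the registered
line `signed_halves_two` v3 with its HARDEST stub `stub_zeroKobayashiLower` REPLACED by the descent
half on the `a₂ = 0` sub-row (certificate-shaped per class); composed through the landed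
`supersingularRankZeroAtTwo_of_line_eulerChar` (p434732) and §2. Composition certificate; nothing
asserted beyond the binders. [cite: Kobayashi2003, Thm. 1.2, Thm. 4.1 and Conjecture (p. 2)]
[cite: BDKim2013, Thm. 1.1 and Cor. 3.15] [cite: Sprung2012, §7 (p. 1499)] [cite: Miller2011LMS, Def. 1.1] -/
theorem supersingularRankZeroAtTwo_of_eulerChar_of_upper_of_millerHalves
    (hPub : nonempty_modularParametrizationData ∧ rank_eq_analyticRank_of_analyticRank_le_one)
    (hEC : ∀ (W : WeierstrassCurve ℚ) [W.IsElliptic] [W.IsGloballyMinimal],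
        ¬ W.HasCM → W.analyticRank = 0 → GoodSS W 2 → W.frobeniusTrace 2 = 0 →
        ∀ (κ : ZpExtension ℚ 2) (γ : Field.absoluteGaloisGroup ℚ),
          κ.IsCyclotomic → κ.IsTopGenerator γ → Finite (W.selmerGroupPInfty 2) →
          Finite (endInvariants (conjSignedSelmerInfty W κ 1 γ - 1)) ∧
            ∃ u : ℤ_[2]ˣ, (Nat.card (endInvariants (conjSignedSelmerInfty W κ 1 γ - 1)) : ℚ_[2]) =
              ((u : ℤ_[2]) : ℚ_[2]) * ((2 : ℕ) : ℚ_[2]) ^ (padicValNat 2 W.tamagawaProduct) *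
                (Nat.card (W.selmerGroupPInfty 2) : ℚ_[2]) *
                  (Nat.card (EndCoinvariants (conjSignedSelmerInfty W κ 1 γ - 1)) : ℚ_[2]))
    (hup : ∀ (W : WeierstrassCurve ℚ) [W.IsElliptic] [W.IsGloballyMinimal],
      ¬ W.HasCM → W.analyticRank = 0 → GoodSS W 2 → W.frobeniusTrace 2 = 0 →
      ∀ (κ : ZpExtension ℚ 2) (γ : Field.absoluteGaloisGroup ℚ),
        κ.IsCyclotomic → κ.IsTopGenerator γ → IsCyclotomicVariable 2 γ →
        ∀ [NeZero (W.conductorNorm ℤ)] (f : CuspForm (Gamma0 (W.conductorNorm ℤ)) 2),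
          IsNewformOf W f → ∀ (ϖ : ℚ), (ϖ : ℝ) * W.realPeriodRat = plusPeriod f →
        ∀ (Lplus Lminus : IwasawaAlgebra 2), IsPollackPair f 2 Lplus Lminus →
        ∀ (D : SignedSelmerDualData W κ γ 1),
          ∃ g h : IwasawaAlgebra 2, D.charIdeal = Ideal.span {g} ∧
            iwasawaToPowerSeries 2 (g * h) =
              PowerSeries.C (ϖ : ℚ_[2]) * iwasawaToPowerSeries 2 (kobayashiL 1 Lplus Lminus))
    (hML : ∀ (W : WeierstrassCurve ℚ) [W.IsElliptic] [W.IsGloballyMinimal],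
      ¬ W.HasCM → W.analyticRank = 0 → GoodSS W 2 → W.frobeniusTrace 2 = 0 →
        MissingLowerBoundAt W 2)
    (hTwo : (∀ (W : WeierstrassCurve ℚ) [W.IsElliptic] [W.IsGloballyMinimal],
        ¬ W.HasCM → W.analyticRank = 0 → GoodSS W 2 →
          (W.frobeniusTrace 2 = 2 ∨ W.frobeniusTrace 2 = -2) → MissingLowerBoundAt W 2) ∧
      (∀ (W : WeierstrassCurve ℚ) [W.IsElliptic] [W.IsGloballyMinimal],
        ¬ W.HasCM → W.analyticRank = 0 → GoodSS W 2 →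
          (W.frobeniusTrace 2 = 2 ∨ W.frobeniusTrace 2 = -2) → MissingUpperBoundAt W 2)) :
    Summit.BirchSwinnertonDyer.BirchSwinnertonDyer.Theses.ByReductionTypeAtTwo.SupersingularRankZeroAtTwo :=
  supersingularRankZeroAtTwo_of_line_eulerChar hPub hEC
    ((zeroKobayashiLower_iff_zeroMillerLower hPub hEC hup).mpr hML) hup hTwo

end ClassLevel

end Summit.BirchSwinnertonDyer.BirchSwinnertonDyer.Theorems

end
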